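import Summits.BirchSwinnertonDyer.BirchSwinnertonDyer.Theorems.PrintCf2RubinValueTwoTowerControlCoker
import HarnessLib

/-!
# Route C `PrintCf2RubinValueTwo`, crux `RestrictedMainConjWithValueAtTwo` (stmt-BirchSwinnertonDyer-23722), brick (RES) — EXACT CONTROL for the
# UNRAMIFIED (Greenberg–Vatsal) datum over the line, and the identification of the local defect: `J = H¹_nr(K_∞^{(2)}, M)`, so that
# `ch_Λ(D₂.X ⧸ T₁ D₂.X) = ch_Λ(D_nr.X)` holds UNCONDITIONALLY on the frames for every `D_nr : DatumDualData κ₂ γ₂ W* (bdpData W* 2 v̄) ∅`, and what is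
# left of (RES) for Agboola's datum is the ONE-VARIABLE comparison `H¹_nr(K*_∞, W*) ⧸ 𝔖_v̄(K*_∞, W*)` finite (strict/locally-trivial vs unramified ON THE LINE)

Cell `bsd-print-cf2`, width seat `bsd-line-cf2c-w8` g0 (prover-bsd-line-cf2c-w8-g0-0); `--supports stmt-BirchSwinnertonDyer-23722`. Sequel of p682128 …
p685195. HONEST FRAMING: nothing here closes the crux or the registered stub; BSD is not proved by any of this; no summit statement is proved by
this seat. No definition, no named fact, no `sorry`. Generic: any number field, any `p`, any discrete `p`-primary `M` with open stabilisers and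
continuous orbits, any generator pair `(κ₁, κ₂; γ₁, γ₂)` with `κ₁` unramified outside `v`, `κ₂` (the line) unramified outside `v̄`, `v̄ ≠ v` over `p`.
* §1 `mem_datumSelmer_bdpData_of_resOfLe_mem` — the converse membership of bsd-eis `mem_datumSelmer_of_resOfLe_mem` with its unramifiedness hypothesis
  asked ONLY where the datum `bdpData M p v̄` imposes a condition (away from `p` and at `v̄`; nothing at the relaxed places above `p`);
  **`comap_resOfLe_unrSelmer₂_eq_unrSelmer`** — `J := (unrSelmer₂ κ₁ κ₂ M v̄).comap res = unrSelmer κ₂ M v̄ ∅` (`I_w ≤ pairKer` for `w ∤ p`,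
  `I_v̄ ≤ ker κ₁`): the local defect of p685013 IS `H¹_nr(K_∞^{(2)}, M) ⧸ 𝔖_v̄(K_∞^{(2)}, M)` — a group ON THE LINE.
* §2 **`exists_linearMap_quotSMulTop_unr`** — for ANY `D₂ : DualData₂ κ₁ κ₂ M v̄ γ₁ γ₂` and ANY `D_nr : DatumDualData κ₂ γ₂ M (bdpData M p v̄) ∅`: a
  `Λ`-linear `f : QuotSMulTop T₁ D₂.X →ₗ[Λ] D_nr.X` (compHom along `PowerSeries.C`), transpose of restriction, which is INJECTIVE (exact control: the
  tower lift p684615 + §1) with cokernel finite `≤ #(M^{pairKer} ⧸ (γ₁ − 1))`.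
* §3 (road α frames) **`charIdeal_quotSMulTop_eq_unr_of_frame`** — `ArePseudoIsomorphic Λ (QuotSMulTop T₁ D₂.X) D_nr.X` and
  `charIdeal Λ (QuotSMulTop T₁ D₂.X) = charIdeal Λ D_nr.X`, NO displayed hypothesis. So TURNKEY §2 (RES) holds VERBATIM for the Greenberg–Vatsal datum;
  for Agboola's `RestrictedDualData` it holds modulo `Finite (unrSelmer κ₂ W* v̄ ∅ ⧸ 𝔖)` (p685013 + §1), a one-variable local statement on `K*_∞`.
presearch: Greenberg–Vatsal 2000 §2; Agboola 2007 §3 Prop. 3.2; Skinner–Urban 2014 Prop. 3.2.8 — held; tree assembly, no new fact. beyond-print: no.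

References: [GreenbergVatsal2000] §2 pp. 17–21; [Agboola2007] §3 Prop. 3.2, §4; [SkinnerUrban2014] §3.2.7–3.2.9; [GreenbergLNM1716] §3.
-/

noncomputable section

open scoped Classical Pointwise
-- the summit namespace `Summit.BirchSwinnertonDyer.BirchSwinnertonDyer` repeats the problem name by design (D-0017)
set_option linter.dupNamespace false
set_option autoImplicit false

open NumberField IsDedekindDomain Field WeierstrassCurve
open Literature.NumberTheory.EllipticCurves Literature.NumberTheory.EllipticCurves.GreenbergSelmer
open Literature.NumberTheory.EllipticCurves.GreenbergVatsal2000 Literature.NumberTheory.EllipticCurves.KellerYin2024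
open Literature.NumberTheory.EllipticCurves.Agboola2007
open Literature.NumberTheory.EllipticCurves.IwasawaDual
open Literature.NumberTheory.GaloisRepresentations
open Summit.BirchSwinnertonDyer.BirchSwinnertonDyer.Theorems.IwasawaTwoVariable
open Summit.BirchSwinnertonDyer.BirchSwinnertonDyer.Theorems.PrintCf2.RestrictedSelmerPair

universe u

namespace Summit.BirchSwinnertonDyer.BirchSwinnertonDyer.Theorems.PrintCf2.LinePush

/-! ## §1. The local defect lives on the line: `J = H¹_nr(K_∞^{(2)}, M)` -/

section Membership

variable {K : Type u} [Field K] [NumberField K] {S H : Subgroup (absoluteGaloisGroup K)} [S.Normal] [H.Normal]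
  {M : Type u} [AddCommGroup M] [DistribMulAction (absoluteGaloisGroup K) M] [TopologicalSpace M] [DiscreteTopology M]
  {p : ℕ} {𝔭 : HeightOneSpectrum (𝓞 K)}

/-- **Converse membership for the datum `bdpData M p 𝔭`** (unramified away from `p`, Greenberg's inertia condition `M⁺ = 0` at `𝔭`, NOTHING at
the other places above `p`): if `H ⊓ I_w ≤ S` at every `w ∤ p` and at `w = 𝔭`, a class of `H¹(H, M)` whose restriction to `S` lies in the datum
Selmer group over `K̄^S` lies in the one over `K̄^H` — bsd-eis `mem_datumSelmer_of_resOfLe_mem` with its hypothesis restricted to the places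
where the datum has a condition (at a relaxed place the condition is `⊤`, `greenbergKer_relaxedDatum_eq_top`). [cite: GreenbergVatsal2000, §2 pp. 17, 20] -/
theorem mem_datumSelmer_bdpData_of_resOfLe_mem (hSH : S ≤ H)
    (hI : ∀ w : HeightOneSpectrum (𝓞 K), ((p : ℕ) : 𝓞 K) ∉ w.asIdeal ∨ w = 𝔭 → H ⊓ inertia w ≤ S) {c : subgroupH1 H M}
    (hc : resOfLe M hSH c ∈ datumSelmer S M p (Castella2018.AcSelmer.bdpData M p 𝔭) ∅) :
    c ∈ datumSelmer H M p (Castella2018.AcSelmer.bdpData M p 𝔭) ∅ := by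
  rw [mem_datumSelmer_iff, mem_unramifiedOutside_iff] at hc ⊢
  refine ⟨fun v hv hpv σ ↦ ?_, fun v hv σ ↦ ?_⟩
  · have h := hc.1 v hv hpv σ
    rw [← resOfLe_conjH1_comm hSH] at h
    have h' : resH1Hom (inertiaInToH S v) (AddMonoidHom.id M) (id_smul_inertiaInToH S v) (resOfLe M hSH (conjH1 H M σ c)) = 0 := h
    rw [resH1Hom_inertiaIn_resOfLe_id] at h'
    have hinj : Function.Injective (Literature.NumberTheory.EllipticCurves.resOfLe M (inertiaIn_mono hSH v)) :=
      resOfLe_injective_of_ge M (inertiaIn_mono hSH v) (inertiaIn_le_of_inf_inertia_le v (hI v (Or.inl hpv)))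
    exact (injective_iff_map_eq_zero _).1 hinj _ h'
  · by_cases hv𝔭 : v = 𝔭
    · subst hv𝔭
      have h := hc.2 v hv σ
      rw [← resOfLe_conjH1_comm hSH, LocalDatum.mem_greenbergKer_iff, greenbergMap_resOfLe] at h
      have hinj : Function.Injective
          (Literature.NumberTheory.EllipticCurves.resOfLe (Castella2018.AcSelmer.bdpData M p v v hv).Gr (inertiaIn_mono hSH v)) :=
        resOfLe_injective_of_ge _ (inertiaIn_mono hSH v) (inertiaIn_le_of_inf_inertia_le v (hI v (Or.inr rfl)))
      rw [LocalDatum.mem_greenbergKer_iff]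
      exact (injective_iff_map_eq_zero _).1 hinj _ h
    · rw [Castella2018.AcSelmer.bdpData_of_ne p 𝔭 hv hv𝔭, greenbergKer_relaxedDatum_eq_top]
      exact AddSubgroup.mem_top _

end Membership

section Line

variable {K : Type u} [Field K] [NumberField K] {p : ℕ} [Fact p.Prime] {κ₁ κ₂ : ZpExtension K p}
  {M : Type u} [AddCommGroup M] [DistribMulAction (absoluteGaloisGroup K) M] [TopologicalSpace M] [DiscreteTopology M]
  {v vbar : HeightOneSpectrum (𝓞 K)}

/-- **`J = H¹_nr(K_∞^{(2)}, M)`**: for `κ₁` unramified outside `v`, `κ₂` unramified outside `v̄`, `v̄ ≠ v` both above `p`, a class over the line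
`K_∞^{(2)} = K̄^{ker κ₂}` restricts into `unrSelmer₂ κ₁ κ₂ M v̄ = H¹_nr(K̃_∞, M)` IFF it lies in `unrSelmer κ₂ M v̄ ∅ = H¹_nr(K_∞^{(2)}, M)` (unramified away
from `p` and above `v̄`, nothing above `v`): `⇐` bsd-eis `resOfLe_mem_datumSelmer`; `⇒` §1 with `I_w ≤ ker κ₁ ⊓ ker κ₂` at `w ∤ p` and
`ker κ₂ ⊓ I_v̄ ≤ pairKer` (`I_v̄ ≤ ker κ₁`). So the local defect `J ⧸ 𝔖` of p685013 is the one-variable group `H¹_nr(K_∞^{(2)}, M) ⧸ 𝔖_v̄(K_∞^{(2)}, M)`.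
[cite: GreenbergVatsal2000, §2 pp. 17, 20] [cite: Agboola2007, §3 Prop. 3.2] -/
theorem comap_resOfLe_unrSelmer₂_eq_unrSelmer (hκ₁ : κ₁.IsUnramifiedOutside v) (hκ₂ : κ₂.IsUnramifiedOutside vbar) (hne : vbar ≠ v)
    (hv : ((p : ℕ) : 𝓞 K) ∈ v.asIdeal) :
    (unrSelmer₂ κ₁ κ₂ M vbar).comap (resOfLe M (ZpExtension.pairKer_le_right κ₁ κ₂)) = unrSelmer κ₂ M vbar ∅ := by
  have hI : ∀ w : HeightOneSpectrum (𝓞 K), ((p : ℕ) : 𝓞 K) ∉ w.asIdeal ∨ w = vbar →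
      κ₂.kerSubgroup ⊓ inertia w ≤ ZpExtension.pairKer κ₁ κ₂ := by
    intro w hw x hx
    have hwv : w ≠ v := by
      rcases hw with hw | rfl
      · exact fun h ↦ hw (h ▸ hv)
      · exact hne
    exact Subgroup.mem_inf.mpr ⟨hκ₁ w hwv hx.2, hx.1⟩
  ext c
  rw [AddSubgroup.mem_comap]
  constructor
  · intro hc
    exact mem_datumSelmer_bdpData_of_resOfLe_mem (ZpExtension.pairKer_le_right κ₁ κ₂) hI hc
  · intro hc
    have _ := hκ₂
    exact resOfLe_mem_datumSelmer p (Castella2018.AcSelmer.bdpData M p vbar) ∅ (ZpExtension.pairKer_le_right κ₁ κ₂) hc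

/-! ## §2. Exact control for the unramified datum over the line -/

variable {γ₁ γ₂ : absoluteGaloisGroup K}

/-- **(RES) FOR THE GREENBERG–VATSAL DATUM: the `Λ`-linear control map `QuotSMulTop T₁ D₂.X →ₗ[Λ] D_nr.X` is INJECTIVE with FINITE COKERNEL.**
For a generator pair `(κ₁, κ₂; γ₁, γ₂)` with `κ₁` unramified outside `v`, the line `κ₂` unramified outside `v̄` (`v̄ ≠ v` over `p`), a discrete `p`-primary
`M` with open stabilisers and continuous orbits and `M^{Gal(K̄/K̃_∞)} ⧸ (γ₁ − 1)` finite, ANY `D₂ : DualData₂ κ₁ κ₂ M v̄ γ₁ γ₂` and ANY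
`D_nr : DatumDualData κ₂ γ₂ M (bdpData M p v̄) ∅` (the `Λ`-dual of `H¹_nr(K_∞^{(2)}, M)`): there is a `Λ`-linear `f` (compHom along `PowerSeries.C`),
`D_nr.toDual (f [x]) t = D₂.toDual x (res t)`, which is INJECTIVE — control is EXACT: every `γ₁`-invariant class of `H¹_nr(K̃_∞, M)` is the restriction
of a class of `H¹_nr(K_∞^{(2)}, M)` (tower lift p684615 + `comap_resOfLe_unrSelmer₂_eq_unrSelmer`), and a character killing the `γ₁`-invariants lies in
`T₁ D₂.X` — with cokernel finite, `# ≤ #(M^{pairKer} ⧸ (γ₁ − 1))` (p683075 §3). [cite: GreenbergVatsal2000, §2 pp. 17–21]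
[cite: SkinnerUrban2014, Prop. 3.2.8 (p. 23)] [cite: GreenbergLNM1716, §3 Lemmas 3.1–3.2] -/
theorem exists_linearMap_quotSMulTop_unr (hγ : ZpExtension.IsTopGeneratorPair κ₁ κ₂ γ₁ γ₂)
    (hκ₁ : κ₁.IsUnramifiedOutside v) (hκ₂ : κ₂.IsUnramifiedOutside vbar) (hne : vbar ≠ v) (hv : ((p : ℕ) : 𝓞 K) ∈ v.asIdeal)
    (htor : ∀ m : M, ∃ k : ℕ, p ^ k • m = 0)
    (hstab : ∀ m : M, IsOpen (MulAction.stabilizer (absoluteGaloisGroup K) m : Set (absoluteGaloisGroup K)))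
    (hcont : ∀ m : M, Continuous fun g : absoluteGaloisGroup K ↦ g • m)
    [Finite (FixedPoints.addSubgroup (ZpExtension.pairKer κ₁ κ₂) M ⧸ (ResKernel.subOne (ZpExtension.pairKer κ₁ κ₂) M γ₁).range)]
    (D₂ : DualData₂ κ₁ κ₂ M vbar γ₁ γ₂) (D : DatumDualData κ₂ γ₂ M (Castella2018.AcSelmer.bdpData M p vbar) ∅) :
    letI : Module (IwasawaAlgebra p) (QuotSMulTop (PowerSeries.X : IwasawaAlgebra₂ p) D₂.X) :=
      Module.compHom _ (PowerSeries.C (R := IwasawaAlgebra p))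
    ∃ f : QuotSMulTop (PowerSeries.X : IwasawaAlgebra₂ p) D₂.X →ₗ[IwasawaAlgebra p] D.X,
      (∀ (x : D₂.X) (t : unrSelmer κ₂ M vbar ∅), D.toDual (f (Submodule.Quotient.mk x)) t =
        D₂.toDual x ⟨resOfLe M (ZpExtension.pairKer_le_right κ₁ κ₂) (t : subgroupH1 κ₂.kerSubgroup M),
          resOfLe_mem_datumSelmer p (Castella2018.AcSelmer.bdpData M p vbar) ∅ (ZpExtension.pairKer_le_right κ₁ κ₂) t.2⟩) ∧
      Function.Injective f ∧
      (Finite (D.X ⧸ LinearMap.range f) ∧ Nat.card (D.X ⧸ LinearMap.range f) ≤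
        Nat.card (FixedPoints.addSubgroup (ZpExtension.pairKer κ₁ κ₂) M ⧸ (ResKernel.subOne (ZpExtension.pairKer κ₁ κ₂) M γ₁).range)) := by
  letI inst : Module (IwasawaAlgebra p) (QuotSMulTop (PowerSeries.X : IwasawaAlgebra₂ p) D₂.X) :=
    Module.compHom _ (PowerSeries.C (R := IwasawaAlgebra p))
  set res := resOfLe M (ZpExtension.pairKer_le_right κ₁ κ₂) with hres
  -- the control map on the unramified group of the line
  let g : unrSelmer κ₂ M vbar ∅ →+ unrSelmer₂ κ₁ κ₂ M vbar :=
    ((res).restrict (unrSelmer κ₂ M vbar ∅)).codRestrict (unrSelmer₂ κ₁ κ₂ M vbar)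
      fun t ↦ resOfLe_mem_datumSelmer p (Castella2018.AcSelmer.bdpData M p vbar) ∅ (ZpExtension.pairKer_le_right κ₁ κ₂) t.2
  have hg : ∀ t, ((g t : unrSelmer₂ κ₁ κ₂ M vbar) : subgroupH1 (ZpExtension.pairKer κ₁ κ₂) M) = res (t : subgroupH1 κ₂.kerSubgroup M) :=
    fun _ ↦ rfl
  have hg₁ : ∀ t, conjSel₂ κ₁ κ₂ M vbar γ₁ (g t) = g t := fun t ↦ by
    apply Subtype.ext
    rw [coe_conjSel₂_apply, hg]
    exact conjH1_resOfLe_pairKer_right_of_mem hγ.2.1 _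
  have hg₂ : ∀ t, conjSel₂ κ₁ κ₂ M vbar γ₂ (g t) = g (conjUnr κ₂ M vbar ∅ γ₂ t) := fun t ↦ by
    apply Subtype.ext
    rw [coe_conjSel₂_apply, hg, hg]
    exact (resOfLe_conjH1_comm (ZpExtension.pairKer_le_right κ₁ κ₂) γ₂ _).symm
  -- the transpose along `constantCoeff`
  have hT := isLocNil_conjUnr_sub_one κ₂ vbar (∅ : Set (HeightOneSpectrum (𝓞 K))) htor hstab hγ.right
  have hTT : ∀ (y : D.X) (t : unrSelmer κ₂ M vbar ∅),
      D.toDual ((PowerSeries.X : IwasawaAlgebra p) • y) t = D.toDual y (conjUnr κ₂ M vbar ∅ γ₂ t) - D.toDual y t :=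
    fun y t ↦ D.toDual_T_smul y t
  obtain ⟨φ, hφ'⟩ := exists_semilinear_restrict_outer (conjSel₂ κ₁ κ₂ M vbar γ₁) (conjSel₂ κ₁ κ₂ M vbar γ₂) (conjUnr κ₂ M vbar ∅ γ₂) g
    D₂.toDual D.toDual hT D.bijective D₂.toDual_T₁_smul D₂.toDual_T₂_smul D₂.toDual_C_smul hTT D.toDual_C_smul hg₁ hg₂
  have hφ : ∀ (x : D₂.X) (t : unrSelmer κ₂ M vbar ∅), D.toDual (φ x) t = D₂.toDual x (g t) := fun x t ↦ by
    rw [hφ', AddMonoidHom.comp_apply]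
  -- `φ` kills `T₁ • ⊤`; descend
  have hX : ∀ x : D₂.X, φ ((PowerSeries.X : IwasawaAlgebra₂ p) • x) = 0 := fun x ↦ by
    rw [LinearMap.map_smulₛₗ, PowerSeries.constantCoeff_X, zero_smul]
  have hle : (PowerSeries.X : IwasawaAlgebra₂ p) • (⊤ : Submodule (IwasawaAlgebra₂ p) D₂.X) ≤ LinearMap.ker φ := by
    intro x hx
    obtain ⟨y, -, rfl⟩ := (Submodule.mem_smul_pointwise_iff_exists _ _ _).mp hx
    exact hX y
  let f₀ : QuotSMulTop (PowerSeries.X : IwasawaAlgebra₂ p) D₂.X →ₛₗ[PowerSeries.constantCoeff (R := IwasawaAlgebra p)] D.X :=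
    ((PowerSeries.X : IwasawaAlgebra₂ p) • (⊤ : Submodule (IwasawaAlgebra₂ p) D₂.X)).liftQ φ hle
  have hf₀ : ∀ x : D₂.X, f₀ (Submodule.Quotient.mk x) = φ x := fun x ↦ rfl
  let f : QuotSMulTop (PowerSeries.X : IwasawaAlgebra₂ p) D₂.X →ₗ[IwasawaAlgebra p] D.X :=
    { toFun := f₀
      map_add' := f₀.map_add
      map_smul' := fun a q ↦ by
        change f₀ ((PowerSeries.C a : IwasawaAlgebra₂ p) • q) = a • f₀ q
        rw [f₀.map_smulₛₗ, PowerSeries.constantCoeff_C] }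
  have hf : ∀ x : D₂.X, f (Submodule.Quotient.mk x) = φ x := hf₀
  refine ⟨f, fun x t ↦ by rw [hf, hφ]; rfl, ?_, ?_⟩
  · -- injective: exact control
    rw [injective_iff_map_eq_zero]
    intro q hq
    obtain ⟨x, rfl⟩ := Submodule.Quotient.mk_surjective _ q
    rw [hf] at hq
    -- `D₂.toDual x` kills the image of `g`, hence the `γ₁`-invariants (tower lift), hence `x ∈ T₁ D₂.X`
    have hkill : ∀ t : unrSelmer κ₂ M vbar ∅, D₂.toDual x (g t) = 0 := fun t ↦ by rw [← hφ, hq, map_zero, AddMonoidHom.zero_apply]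
    have hvan : ∀ s : unrSelmer₂ κ₁ κ₂ M vbar, (conjSel₂ κ₁ κ₂ M vbar γ₁ - 1) s = 0 → D₂.toDual x s = 0 := by
      intro s hs
      have hs' : conjSel₂ κ₁ κ₂ M vbar γ₁ s = s := by
        change conjSel₂ κ₁ κ₂ M vbar γ₁ s - s = 0 at hs
        rwa [sub_eq_zero] at hs
      obtain ⟨y, hyJ, hy⟩ := exists_mem_comap_resOfLe_eq hγ hcont htor s hs'
      rw [comap_resOfLe_unrSelmer₂_eq_unrSelmer hκ₁ hκ₂ hne hv] at hyJ
      have hgt : g ⟨y, hyJ⟩ = s := Subtype.ext (by rw [hg]; exact hy)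
      rw [← hgt]
      exact hkill _
    obtain ⟨yb, hyb⟩ := IwasawaTwoVariable.exists_comp_eq_of_forall_ker _ _ hvan
    obtain ⟨y', hy'⟩ := D₂.bijective.2 yb
    have hx : x = (PowerSeries.X : IwasawaAlgebra₂ p) • y' := D₂.bijective.1 (by
      ext s
      rw [hyb, AddMonoidHom.comp_apply, IwasawaTwoVariable.toDual_T₁_smul_eq, hy']
      rfl)
    rw [hx]
    exact (Submodule.Quotient.mk_eq_zero _).mpr (Submodule.smul_mem_pointwise_smul y' _ ⊤ Submodule.mem_top)
  · -- cokernel: the image of `φ` is the annihilator of `ker g`, which embeds in `ker res` (finite)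
    have hrange : (LinearMap.range f).toAddSubgroup = φ.toAddMonoidHom.range := by
      ext y
      simp only [Submodule.mem_toAddSubgroup, LinearMap.mem_range, AddMonoidHom.mem_range, LinearMap.toAddMonoidHom_coe]
      constructor
      · rintro ⟨q, rfl⟩
        obtain ⟨x, rfl⟩ := Submodule.Quotient.mk_surjective _ q
        exact ⟨x, (hf x).symm⟩
      · rintro ⟨x, rfl⟩
        exact ⟨Submodule.Quotient.mk x, hf x⟩
    have hR : ∀ y : D.X, y ∈ φ.toAddMonoidHom.range ↔ ∀ t : unrSelmer κ₂ M vbar ∅, g t = 0 → D.toDual y t = 0 := by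
      intro y
      constructor
      · rintro ⟨x, rfl⟩ t ht
        rw [LinearMap.toAddMonoidHom_coe, hφ, ht, map_zero]
      · intro hy
        obtain ⟨ψ, hψ⟩ := IwasawaTwoVariable.exists_comp_eq_of_forall_ker_of_hom g (D.toDual y) hy
        obtain ⟨x, hx⟩ := D₂.bijective.2 ψ
        refine ⟨x, D.bijective.1 ?_⟩
        ext t
        rw [LinearMap.toAddMonoidHom_coe, hφ, hx, hψ, AddMonoidHom.comp_apply]
    -- `ker g ↪ ker res`, finite
    obtain ⟨hfinK, hcardK⟩ := finite_ker_resOfLe_pairKer_right_and_card_le (M := M) hγ hcont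
    let i : g.ker → (resOfLe M (ZpExtension.pairKer_le_right κ₁ κ₂)).ker := fun t ↦
      ⟨((t : unrSelmer κ₂ M vbar ∅) : subgroupH1 κ₂.kerSubgroup M), by
        have ht : g (t : unrSelmer κ₂ M vbar ∅) = 0 := (AddMonoidHom.mem_ker).mp t.2
        rw [AddMonoidHom.mem_ker, ← hres, ← hg, ht]
        rfl⟩
    have hi : Function.Injective i := fun s t hst ↦
      Subtype.ext (Subtype.ext (congrArg (fun x ↦ (x.1 : subgroupH1 κ₂.kerSubgroup M)) hst))
    haveI := hfinK
    haveI : Finite g.ker := Finite.of_injective i hi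
    obtain ⟨h1, h2⟩ := finite_quotient_and_card_le_of_annihilator D.toDual g φ.toAddMonoidHom.range hR
    let e : D.X ⧸ LinearMap.range f ≃+ D.X ⧸ φ.toAddMonoidHom.range := QuotientAddGroup.quotientAddEquivOfEq hrange
    exact ⟨Finite.of_equiv _ e.toEquiv.symm,
      ((Nat.card_congr e.toEquiv).trans_le h2).trans ((Nat.card_le_card_of_injective i hi).trans hcardK)⟩

end Line

/-! ## §3. Road α frames: (RES) for the Greenberg–Vatsal datum, unconditionally -/

section Frame

variable {K : Type} [Field K] [NumberField K]

/-- **(RES) FOR THE UNRAMIFIED DATUM ON EVERY FRAME, NO DISPLAYED HYPOTHESIS.** Member `C • W = cm7^{(d)}`, `K` imaginary quadratic, `v ≠ v̄` over `2`,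
ANY `π, r` (`W* = ↥((W.baseChange K).endEigenPrimaryTorsion 2 π r)`), a generator pair `(κ₁, κ₂; γ₁, γ₂)` with `κ₁` unramified outside `v`, the line
`κ₂` unramified outside `v̄`, ANY `D₂ : DualData₂ κ₁ κ₂ W* v̄ γ₁ γ₂` and ANY `D_nr : DatumDualData κ₂ γ₂ W* (bdpData W* 2 v̄) ∅`: `QuotSMulTop T₁ D₂.X` and
`D_nr.X` are PSEUDO-ISOMORPHIC `Λ`-modules (`Λ` through `PowerSeries.C`) and **`ch_Λ(D₂.X ⧸ T₁ D₂.X) = ch_Λ(D_nr.X)`** (`W*(K̃_∞)` finite,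
p682650/p683924; exact control §2). [cite: GreenbergVatsal2000, §2 pp. 17–21] [cite: Agboola2007, §4] [cite: SkinnerUrban2014, Cor. 3.2.9 (ii)] -/
theorem charIdeal_quotSMulTop_eq_unr_of_frame {d : ℤ} (hd0 : d ≠ 0) (W : WeierstrassCurve ℚ) [W.IsElliptic]
    (C : VariableChange ℚ) (hC : C • W = cm7.quadraticTwist (d : ℚ)) (hK : IsImaginaryQuadratic K)
    (v vbar : HeightOneSpectrum (𝓞 K)) (hv : ((2 : ℕ) : 𝓞 K) ∈ v.asIdeal) (hvbar : ((2 : ℕ) : 𝓞 K) ∈ vbar.asIdeal) (hne : vbar ≠ v)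
    (π : (W.baseChange K).endRing) (r : ℤ_[2]) (κ₁ κ₂ : ZpExtension K 2) (hκ₁ : κ₁.IsUnramifiedOutside v)
    (hκ₂ : κ₂.IsUnramifiedOutside vbar) {γ₁ γ₂ : absoluteGaloisGroup K} (hγ : ZpExtension.IsTopGeneratorPair κ₁ κ₂ γ₁ γ₂)
    (D₂ : DualData₂ κ₁ κ₂ ↥((W.baseChange K).endEigenPrimaryTorsion 2 π r) vbar γ₁ γ₂)
    (D : DatumDualData κ₂ γ₂ ↥((W.baseChange K).endEigenPrimaryTorsion 2 π r)
      (Castella2018.AcSelmer.bdpData ↥((W.baseChange K).endEigenPrimaryTorsion 2 π r) 2 vbar) ∅) :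
    letI : Module (IwasawaAlgebra 2) (QuotSMulTop (PowerSeries.X : IwasawaAlgebra₂ 2) D₂.X) :=
      Module.compHom _ (PowerSeries.C (R := IwasawaAlgebra 2))
    Module.ArePseudoIsomorphic (IwasawaAlgebra 2) (QuotSMulTop (PowerSeries.X : IwasawaAlgebra₂ 2) D₂.X) D.X ∧
      Module.charIdeal (IwasawaAlgebra 2) (QuotSMulTop (PowerSeries.X : IwasawaAlgebra₂ 2) D₂.X) =
        Module.charIdeal (IwasawaAlgebra 2) D.X := by
  letI inst : Module (IwasawaAlgebra 2) (QuotSMulTop (PowerSeries.X : IwasawaAlgebra₂ 2) D₂.X) :=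
    Module.compHom _ (PowerSeries.C (R := IwasawaAlgebra 2))
  have htor : ∀ m : ↥((W.baseChange K).endEigenPrimaryTorsion 2 π r), ∃ k : ℕ, 2 ^ k • m = 0 :=
    exists_pow_smul_endEigenPrimaryTorsion_eq_zero (W.baseChange K) 2 π r
  have hstab : ∀ m : ↥((W.baseChange K).endEigenPrimaryTorsion 2 π r),
      IsOpen (MulAction.stabilizer (absoluteGaloisGroup K) m : Set (absoluteGaloisGroup K)) :=
    isOpen_stabilizer_endEigenPrimaryTorsion (W.baseChange K) 2 π r
  have hcont : ∀ m : ↥((W.baseChange K).endEigenPrimaryTorsion 2 π r), Continuous fun σ : absoluteGaloisGroup K ↦ σ • m :=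
    continuous_smul_endEigenPrimaryTorsion (W.baseChange K) 2 π r
  haveI hF : Finite (FixedPoints.addSubgroup (ZpExtension.pairKer κ₁ κ₂) ↥((W.baseChange K).endEigenPrimaryTorsion 2 π r)) :=
    finite_fixedPoints_pairKer_of_frame_right hd0 W C hC hK v vbar hv hvbar π r κ₁ κ₂ hκ₁ hκ₂
  haveI : Finite (FixedPoints.addSubgroup (ZpExtension.pairKer κ₁ κ₂) ↥((W.baseChange K).endEigenPrimaryTorsion 2 π r) ⧸
      (ResKernel.subOne (ZpExtension.pairKer κ₁ κ₂) ↥((W.baseChange K).endEigenPrimaryTorsion 2 π r) γ₁).range) := inferInstance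
  refine (exists_linearMap_quotSMulTop_unr hγ hκ₁ hκ₂ hne hv htor hstab hcont D₂ D).elim fun f hf ↦ ?_
  have hker : Module.IsPseudoNull (IwasawaAlgebra 2) (LinearMap.ker f) := by
    haveI : Finite (LinearMap.ker f) := by
      rw [LinearMap.ker_eq_bot.mpr hf.2.1]
      infer_instance
    exact isPseudoNull_of_finite 2 _
  haveI := hf.2.2.1
  have hpi : Module.ArePseudoIsomorphic (IwasawaAlgebra 2) (QuotSMulTop (PowerSeries.X : IwasawaAlgebra₂ 2) D₂.X) D.X :=
    ⟨f, hker, isPseudoNull_of_finite 2 _⟩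
  exact ⟨hpi, Module.charIdeal_eq_of_arePseudoIsomorphic hpi⟩

end Frame

end Summit.BirchSwinnertonDyer.BirchSwinnertonDyer.Theorems.PrintCf2.LinePush
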